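import Summits.RiemannHypothesis.RiemannHypothesis.Theorems.PfPersistenceDefectiveTransport
import Summits.RiemannHypothesis.RiemannHypothesis.Theorems.SoloInformedQuasiWeilCriterion
import HarnessLib

/-!
# T-D needs no seed: the defective transport from ANY base, its additive-gauge form, and the
# exact-thermometer dictionary (leaf G1.22 TRANSPORT, part 4)

pub-rhpf cell (mechanism/rigidity campaign; **no RH claims**), seat `pub-rhpf-transport-1` gen 5.
Companion of `PfPersistenceDefectiveTransport.lean` (part 1, T-D: transport of `Q = ε + (C/δ)e^{δa}`).

## What is proved here (all RH-free, all CONDITIONAL on the stated clause; def-free)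

Write `ε = weilGroundEnergy` (the bottom of Weil's quadratic functional on the window `[-a, a]`) and call
*defective leakage clause at rate `δ > 0` with constant `C ≥ 0` from the base `b`* the per-compact-range
lower-right-Dini statement of part 1: for every `A ≥ b` there is `K ≥ 0` with
`ε x − ε (x + h) ≤ h (K ε x + C e^{δx} + η)` for arbitrarily small `h > 0`, at every `x ∈ [b, A)`, `η > 0`;
its `K ≡ 0` member is the *speed limit* `ε x − ε (x + h) ≤ h (C e^{δx} + η)`.

1. **No seed, no base** (`floor_of_defectiveLeakage`, `strip_half_of_defectiveLeakage`,
   `quasiRiemannHypothesis_of_defectiveLeakage`).  Part 1 transported from a seed window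
   `a₀ < (log 3)/2` where `ε > 0` is PROVED.  The seed is unnecessary: from ANY base `b > 0`, whatever the
   sign of `ε b`, the clause at rate `δ` implies an eventual floor `ε a ≥ −C' e^{δa}` (`a ≥ b`) — enlarge
   `C` until `ε b + (C/δ)e^{δb} > 0`, which changes the floor constant but not its RATE — and hence, by the
   tree's exact-thermometer lemma `abs_re_sub_half_le_of_weilGroundEnergy_exp_lower`
   (`SoloInformedQuasiWeilCriterion.lean`; eventual floors suffice, factor `1/2` included), every
   non-trivial zero has `|Re ρ − 1/2| ≤ δ/2`, i.e. `QuasiRiemannHypothesis (1/2 + δ/2)`.  So the PROVED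
   small-window base of leaf G1.22 plays NO role in any graded member of the transport programme; it matters
   only for the defect-free member `C = 0` (positivity transport, RH-strength, part 1
   `riemannHypothesis_of_diniLeakageFrom`).
2. **All rates, seed-free** (`riemannHypothesis_of_defectiveLeakage_all`, `riemannHypothesis_of_subexpSpeed`):
   the clause (or the speed limit) at EVERY rate `δ > 0`, each from its own base `b_δ` with its own
   constant, implies RH (`riemannHypothesis_of_weilGroundEnergy_subexp`, Solo).
3. **The additive gauge** (`speedLimit_iff_monotoneOn_addGauge`, `strip_half_of_monotoneOn_addGauge`):
   the speed limit at rate `δ` from `b` holds IFF `a ↦ ε a + (C/δ) e^{δa}` is non-decreasing on `[b, ∞)`.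
   This is the ADDITIVE twin of the cell's multiplicative law MONO-F (`a ↦ e^{4πe^{2a}} ε a` non-decreasing,
   RH-strength when seeded): an additive exponential gauge of rate `δ` that makes the Weil bottom eventually
   monotone puts every zero in `|Re ρ − 1/2| ≤ δ/2` — with no seed at all.
4. **Ω-forms** (`defectiveLeakage_fails_of_offline_zero`, `not_monotoneOn_addGauge_of_offline_zero`,
   `exists_rate_of_not_riemannHypothesis`): a zero at offset `β₀ > δ/2` defeats the clause and the gauge from
   EVERY base with EVERY constant; off RH some rate `δ > 0` admits no additive gauge from any base.

## What is NOT proved (and is not claimed)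
* `quasi-RH ⟹ clause` (strip ⟹ speed limit).  The tree's exact thermometer
  (`SoloInformedQuasiWeil.lean`, `width_iff_weilQuadratic_sobolev_subexp`) gives strip ⟹ FLOOR in the
  Sobolev normalisation and, in the `L²` normalisation, under vertically sparse off-line zeros
  (`weilGroundEnergy_ge_of_sparse_offline`); the remaining gap floor ⟹ speed limit ("no cliffs": an
  a-priori bound on the lower right Dini slope of `−ε`, i.e. on the edge intensity of ground states) is open
  even at rates `δ > 1`, where the FLOOR is unconditional (`weilGroundEnergy_exp_lower_of_one_lt`).
* `RH ⟹ speed limit`.  Under RH only the `K`-clause is available (part 2,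
  `defectiveLeakageFrom_of_riemannHypothesis`, via `WindowLipschitz`); the pure speed limit is not known
  to follow from RH.

References: E. Bombieri, *Remarks on Weil's quadratic functional in the theory of prime numbers I*,
Rend. Mat. Acc. Lincei (9) 11 (2000) 183–233, §4 (the functional, the a-priori bound); H. Yoshida, *On
Hermitian forms attached to zeta functions*, Adv. Stud. Pure Math. 21 (1992) 281–325 (the window
criterion).  Every step below is elementary real analysis over tree theorems. [folklore]
-/

noncomputable section

set_option linter.dupNamespace false  -- D-0017 nested layout: `RiemannHypothesis.RiemannHypothesis`

namespace Summit.RiemannHypothesis.RiemannHypothesis.Theorems.PfPersistenceDefectiveTransport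

open Set Filter Topology
open _root_.Literature.NumberTheory.LFunctions
open _root_.Summit.RiemannHypothesis.RiemannHypothesis.Theorems.WeilWindowFlowDiniLeakage
  (continuousOn_weilGroundEnergy_Icc)

/-! ## 1. Any base, any sign of `ε b`: the seed is absorbed into the defect constant -/

/-- **Fence from a base where the transported quantity is positive.**  If `0 < ε b + (C/δ) e^{δb}` and the
defective leakage clause at rate `δ` with constant `C` holds from `b > 0`, then `−(C/δ) e^{δa} < ε a` for every
`a ≥ b` (part 1's argument with the seed replaced by the hypothesis `hseed`). CONDITIONAL; RH-free. [folklore] -/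
theorem floor_of_defectiveLeakage_of_seed {b C δ : ℝ} (hb : 0 < b) (hC : 0 ≤ C) (hδ : 0 < δ)
    (hseed : 0 < weilGroundEnergy b + C / δ * Real.exp (δ * b))
    (h : ∀ A : ℝ, b ≤ A → ∃ K : ℝ, 0 ≤ K ∧ ∀ x ∈ Ico b A, ∀ η δ' : ℝ, 0 < η → 0 < δ' →
      ∃ h : ℝ, 0 < h ∧ h < δ' ∧
        weilGroundEnergy x - weilGroundEnergy (x + h) ≤
          h * (K * weilGroundEnergy x + C * Real.exp (δ * x) + η)) :
    ∀ a : ℝ, b ≤ a → -(C / δ * Real.exp (δ * a)) < weilGroundEnergy a := by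
  intro a hba
  obtain ⟨K, hK, hKD⟩ := h a hba
  have hΦc : ContinuousOn (fun x ↦ C / δ * Real.exp (δ * x)) (Icc b a) := by fun_prop
  exact neg_lt_of_defectiveDini (f := weilGroundEnergy) (Φ := fun x ↦ C / δ * Real.exp (δ * x))
    (D := fun x ↦ C * Real.exp (δ * x)) (b := b) (c := a) (K := K) hK
    (continuousOn_weilGroundEnergy_Icc hb) hΦc (fun x _ ↦ by positivity)
    (fun x _ hh hhpos ↦ exp_defect_dominated hC hδ x hh hhpos) hseed hKD a ⟨hba, le_rfl⟩

/-- Enlarging the defect constant preserves the clause (`h > 0`, `e^{δx} > 0`). [folklore] -/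
theorem defectiveLeakage_mono {b C C' δ : ℝ} (hCC' : C ≤ C')
    (h : ∀ A : ℝ, b ≤ A → ∃ K : ℝ, 0 ≤ K ∧ ∀ x ∈ Ico b A, ∀ η δ' : ℝ, 0 < η → 0 < δ' →
      ∃ h : ℝ, 0 < h ∧ h < δ' ∧
        weilGroundEnergy x - weilGroundEnergy (x + h) ≤
          h * (K * weilGroundEnergy x + C * Real.exp (δ * x) + η)) :
    ∀ A : ℝ, b ≤ A → ∃ K : ℝ, 0 ≤ K ∧ ∀ x ∈ Ico b A, ∀ η δ' : ℝ, 0 < η → 0 < δ' →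
      ∃ h : ℝ, 0 < h ∧ h < δ' ∧
        weilGroundEnergy x - weilGroundEnergy (x + h) ≤
          h * (K * weilGroundEnergy x + C' * Real.exp (δ * x) + η) := by
  intro A hA
  obtain ⟨K, hK, hKD⟩ := h A hA
  refine ⟨K, hK, fun x hx η δ' hη hδ' ↦ ?_⟩
  obtain ⟨h, hh, hhδ, hle⟩ := hKD x hx η δ' hη hδ'
  refine ⟨h, hh, hhδ, hle.trans ?_⟩
  have : C * Real.exp (δ * x) ≤ C' * Real.exp (δ * x) :=
    mul_le_mul_of_nonneg_right hCC' (Real.exp_pos _).le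
  exact mul_le_mul_of_nonneg_left (by linarith) hh.le

/-- **T-D from ANY base: defective leakage ⟹ eventual floor at the same rate.**  For every base `b > 0`
(no sign condition on `ε b`, no seed window), the defective leakage clause at rate `δ` from `b` gives
`C' ≥ 0` with `−C' e^{δa} ≤ ε a` for all `a ≥ b`.  Proof: enlarge `C` to `max C (δ(|ε b| + 1))`, which makes
`ε b + (C/δ)e^{δb}` positive, and run the fence.  CONDITIONAL; RH-free; no RH claim. [folklore] -/
theorem floor_of_defectiveLeakage {b C δ : ℝ} (hb : 0 < b) (hC : 0 ≤ C) (hδ : 0 < δ)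
    (h : ∀ A : ℝ, b ≤ A → ∃ K : ℝ, 0 ≤ K ∧ ∀ x ∈ Ico b A, ∀ η δ' : ℝ, 0 < η → 0 < δ' →
      ∃ h : ℝ, 0 < h ∧ h < δ' ∧
        weilGroundEnergy x - weilGroundEnergy (x + h) ≤
          h * (K * weilGroundEnergy x + C * Real.exp (δ * x) + η)) :
    ∃ C' : ℝ, 0 ≤ C' ∧ ∀ a : ℝ, b ≤ a → -(C' * Real.exp (δ * a)) ≤ weilGroundEnergy a := by
  set C₁ : ℝ := max C (δ * (|weilGroundEnergy b| + 1)) with hC₁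
  have hCC₁ : C ≤ C₁ := le_max_left _ _
  have hC₁0 : 0 ≤ C₁ := hC.trans hCC₁
  have hseed : 0 < weilGroundEnergy b + C₁ / δ * Real.exp (δ * b) := by
    have h1 : δ * (|weilGroundEnergy b| + 1) ≤ C₁ := le_max_right _ _
    have h2 : |weilGroundEnergy b| + 1 ≤ C₁ / δ := by
      rw [le_div_iff₀ hδ]
      linarith
    have h3 : 1 ≤ Real.exp (δ * b) := Real.one_le_exp (by positivity)
    have h4 : C₁ / δ ≤ C₁ / δ * Real.exp (δ * b) :=
      le_mul_of_one_le_right (div_nonneg hC₁0 hδ.le) h3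
    have h5 : -weilGroundEnergy b ≤ |weilGroundEnergy b| := neg_le_abs _
    linarith
  refine ⟨C₁ / δ, div_nonneg hC₁0 hδ.le, fun a hba ↦ ?_⟩
  exact (floor_of_defectiveLeakage_of_seed hb hC₁0 hδ hseed (defectiveLeakage_mono hCC₁ h) a hba).le

/-- **T-D from ANY base ⟹ zero-free strip of half the rate.**  The defective leakage clause at rate `δ`
from some base `b > 0` puts every non-trivial zero of `ζ` in `|Re ρ − 1/2| ≤ δ/2` (tree:
`abs_re_sub_half_le_of_weilGroundEnergy_exp_lower`, eventual floors suffice).  Supersedes part 1's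
`strip_of_defectiveLeakageFrom` (seed `a₀ < (log 3)/2`, width `δ`) on both counts.  Vacuous for `δ ≥ 1`.
CONDITIONAL; RH-free; no RH claim. [folklore] -/
theorem strip_half_of_defectiveLeakage {b C δ : ℝ} (hb : 0 < b) (hC : 0 ≤ C) (hδ : 0 < δ)
    (h : ∀ A : ℝ, b ≤ A → ∃ K : ℝ, 0 ≤ K ∧ ∀ x ∈ Ico b A, ∀ η δ' : ℝ, 0 < η → 0 < δ' →
      ∃ h : ℝ, 0 < h ∧ h < δ' ∧
        weilGroundEnergy x - weilGroundEnergy (x + h) ≤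
          h * (K * weilGroundEnergy x + C * Real.exp (δ * x) + η))
    {ρ : ℂ} (hρ : ρ ∈ ZetaZeros.riemannZetaNontrivialZeros) : |ρ.re - 1 / 2| ≤ δ / 2 := by
  obtain ⟨C', _, hC'⟩ := floor_of_defectiveLeakage hb hC hδ h
  exact abs_re_sub_half_le_of_weilGroundEnergy_exp_lower (κ := δ) (C := C') (a₀ := b) hδ.le hC' hρ

/-- **T-D from ANY base ⟹ `QuasiRiemannHypothesis (1/2 + δ/2)`** (no zero of `ζ` in `1/2 + δ/2 < Re s < 1`).
CONDITIONAL; RH-free; no RH claim. [folklore] -/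
theorem quasiRiemannHypothesis_of_defectiveLeakage {b C δ : ℝ} (hb : 0 < b) (hC : 0 ≤ C) (hδ : 0 < δ)
    (h : ∀ A : ℝ, b ≤ A → ∃ K : ℝ, 0 ≤ K ∧ ∀ x ∈ Ico b A, ∀ η δ' : ℝ, 0 < η → 0 < δ' →
      ∃ h : ℝ, 0 < h ∧ h < δ' ∧
        weilGroundEnergy x - weilGroundEnergy (x + h) ≤
          h * (K * weilGroundEnergy x + C * Real.exp (δ * x) + η)) :
    QuasiRiemannHypothesis (1 / 2 + δ / 2) := by
  intro s hs h0 h1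
  have hmem : s ∈ ZetaZeros.riemannZetaNontrivialZeros :=
    ZetaZeros.riemannZetaNontrivialZeros.mem_iff'.2 ⟨hs, by linarith, h1⟩
  have h2 := strip_half_of_defectiveLeakage hb hC hδ h hmem
  rw [abs_le] at h2
  linarith [h2.2]

/-- **The rate family exhausts to RH — seed-free.**  If for every rate `δ > 0` the defective leakage
clause holds from SOME base `b_δ > 0` with SOME constant `C_δ ≥ 0`, then RH
(`riemannHypothesis_of_weilGroundEnergy_subexp`: sub-exponential eventual floors).  CONDITIONAL;
proof.conditional; credits nothing; no RH claim. [folklore] -/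
theorem riemannHypothesis_of_defectiveLeakage_all
    (h : ∀ δ : ℝ, 0 < δ → ∃ b C : ℝ, 0 < b ∧ 0 ≤ C ∧
      ∀ A : ℝ, b ≤ A → ∃ K : ℝ, 0 ≤ K ∧ ∀ x ∈ Ico b A, ∀ η δ' : ℝ, 0 < η → 0 < δ' →
        ∃ h : ℝ, 0 < h ∧ h < δ' ∧
          weilGroundEnergy x - weilGroundEnergy (x + h) ≤
            h * (K * weilGroundEnergy x + C * Real.exp (δ * x) + η)) :
    _root_.RiemannHypothesis := by
  refine riemannHypothesis_of_weilGroundEnergy_subexp fun κ hκ ↦ ?_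
  obtain ⟨b, C, hb, hC, hcl⟩ := h κ hκ
  obtain ⟨C', _, hC'⟩ := floor_of_defectiveLeakage hb hC hκ hcl
  exact ⟨C', b, hC'⟩

/-- **Speed limit from ANY base ⟹ `QuasiRiemannHypothesis (1/2 + δ/2)`** (the `K ≡ 0` member: the window
bottom eventually never drops faster than `C e^{δx}`).  CONDITIONAL; RH-free; no RH claim. [folklore] -/
theorem quasiRiemannHypothesis_of_speedLimit {b C δ : ℝ} (hb : 0 < b) (hC : 0 ≤ C) (hδ : 0 < δ)
    (h : ∀ x : ℝ, b ≤ x → ∀ η δ' : ℝ, 0 < η → 0 < δ' →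
      ∃ h : ℝ, 0 < h ∧ h < δ' ∧
        weilGroundEnergy x - weilGroundEnergy (x + h) ≤ h * (C * Real.exp (δ * x) + η)) :
    QuasiRiemannHypothesis (1 / 2 + δ / 2) :=
  quasiRiemannHypothesis_of_defectiveLeakage hb hC hδ
    fun A _ ↦ ⟨0, le_rfl, fun x hx η δ' hη hδ' ↦ by simpa using h x hx.1 η δ' hη hδ'⟩

/-- **Sub-exponential descent speed ⟹ RH — seed-free.**  If for every `δ > 0` the speed limit at rate `δ`
holds from some base with some constant, then RH.  CONDITIONAL; proof.conditional; credits nothing; no RH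
claim (the converse, RH ⟹ sub-exponential speed, is NOT known). [folklore] -/
theorem riemannHypothesis_of_subexpSpeed
    (h : ∀ δ : ℝ, 0 < δ → ∃ b C : ℝ, 0 < b ∧ 0 ≤ C ∧ ∀ x : ℝ, b ≤ x → ∀ η δ' : ℝ, 0 < η → 0 < δ' →
      ∃ h : ℝ, 0 < h ∧ h < δ' ∧
        weilGroundEnergy x - weilGroundEnergy (x + h) ≤ h * (C * Real.exp (δ * x) + η)) :
    _root_.RiemannHypothesis :=
  riemannHypothesis_of_defectiveLeakage_all fun δ hδ ↦ by
    obtain ⟨b, C, hb, hC, hcl⟩ := h δ hδ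
    exact ⟨b, C, hb, hC, fun A _ ↦ ⟨0, le_rfl, fun x hx η δ' hη hδ' ↦ by
      simpa using hcl x hx.1 η δ' hη hδ'⟩⟩

/-! ## 2. The additive gauge: speed limit ⟺ `a ↦ ε a + (C/δ) e^{δa}` non-decreasing -/

/-- **Speed limit ⟹ the additive gauge is monotone.**  If the speed limit at rate `δ` with constant `C` holds
from `b > 0`, then `a ↦ ε a + (C/δ) e^{δa}` is non-decreasing on `[b, ∞)` (the `K = 0` fence run from each
point, after shifting `ε` by a constant to make the transported quantity positive).  RH-free. [folklore] -/
theorem monotoneOn_addGauge_of_speedLimit {b C δ : ℝ} (hb : 0 < b) (hC : 0 ≤ C) (hδ : 0 < δ)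
    (h : ∀ x : ℝ, b ≤ x → ∀ η δ' : ℝ, 0 < η → 0 < δ' →
      ∃ h : ℝ, 0 < h ∧ h < δ' ∧
        weilGroundEnergy x - weilGroundEnergy (x + h) ≤ h * (C * Real.exp (δ * x) + η)) :
    MonotoneOn (fun a ↦ weilGroundEnergy a + C / δ * Real.exp (δ * a)) (Ici b) := by
  intro x hx y _ hxy
  rcases hxy.eq_or_lt with rfl | hlt
  · exact le_rfl
  set M : ℝ := |weilGroundEnergy x| + 1 with hM
  have hbx : b ≤ x := hx
  have hxpos : 0 < x := hb.trans_le hbx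
  have hf : ContinuousOn (fun t ↦ weilGroundEnergy t + M) (Icc x y) :=
    (continuousOn_weilGroundEnergy_Icc hxpos).add continuousOn_const
  have hΦc : ContinuousOn (fun t ↦ C / δ * Real.exp (δ * t)) (Icc x y) := by fun_prop
  have hseed : 0 < (weilGroundEnergy x + M) + C / δ * Real.exp (δ * x) := by
    have h1 : -weilGroundEnergy x ≤ |weilGroundEnergy x| := neg_le_abs _
    have h2 : 0 ≤ C / δ * Real.exp (δ * x) := by positivity
    linarith
  have key := floor_of_defectiveDini (f := fun t ↦ weilGroundEnergy t + M)
    (Φ := fun t ↦ C / δ * Real.exp (δ * t)) (D := fun t ↦ C * Real.exp (δ * t))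
    (b := x) (c := y) (K := 0) le_rfl hf hΦc (fun t _ ↦ by positivity)
    (fun t _ hh hhpos ↦ exp_defect_dominated hC hδ t hh hhpos) hseed
    (fun t ht η δ' hη hδ' ↦ by
      obtain ⟨hh, h1, h2, h3⟩ := h t (hbx.trans ht.1) η δ' hη hδ'
      refine ⟨hh, h1, h2, ?_⟩
      have e1 : (weilGroundEnergy t + M) - (weilGroundEnergy (t + hh) + M) =
          weilGroundEnergy t - weilGroundEnergy (t + hh) := by ring
      have e2 : hh * (0 * (weilGroundEnergy t + M) + C * Real.exp (δ * t) + η) =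
          hh * (C * Real.exp (δ * t) + η) := by ring
      rw [e1, e2]
      exact h3)
    y ⟨hxy, le_rfl⟩
  simp only [zero_mul, neg_zero, Real.exp_zero, mul_one] at key
  show weilGroundEnergy x + C / δ * Real.exp (δ * x) ≤ weilGroundEnergy y + C / δ * Real.exp (δ * y)
  linarith

/-- **Monotone additive gauge ⟹ speed limit.**  If `a ↦ ε a + (C/δ) e^{δa}` is non-decreasing on `[b, ∞)`
(`C ≥ 0`, `δ > 0`), the speed limit at rate `δ` with constant `C` holds from `b`: for small `h`,
`(C/δ)(e^{δ(x+h)} − e^{δx}) ≤ h (C e^{δx} + η)`.  RH-free. [folklore] -/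
theorem speedLimit_of_monotoneOn_addGauge {b C δ : ℝ} (hC : 0 ≤ C) (hδ : 0 < δ)
    (hmono : MonotoneOn (fun a ↦ weilGroundEnergy a + C / δ * Real.exp (δ * a)) (Ici b)) :
    ∀ x : ℝ, b ≤ x → ∀ η δ' : ℝ, 0 < η → 0 < δ' →
      ∃ h : ℝ, 0 < h ∧ h < δ' ∧
        weilGroundEnergy x - weilGroundEnergy (x + h) ≤ h * (C * Real.exp (δ * x) + η) := by
  intro x hx η δ' hη hδ'
  set E : ℝ := Real.exp (δ * x) with hE
  have hEpos : 0 < E := Real.exp_pos _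
  set L : ℝ := δ * C * E * Real.exp δ with hL
  have hL0 : 0 ≤ L := by positivity
  set h : ℝ := min (δ' / 2) (min 1 (η / (L + 1))) with hh
  have hpos : 0 < h := lt_min (by linarith) (lt_min one_pos (div_pos hη (by linarith)))
  have hlt : h < δ' := (min_le_left _ _).trans_lt (by linarith)
  have hle1 : h ≤ 1 := (min_le_right _ _).trans (min_le_left _ _)
  have hleη : h ≤ η / (L + 1) := (min_le_right _ _).trans (min_le_right _ _)
  have hLh : L * h ≤ η := by
    have h1 : h * (L + 1) ≤ η := by rwa [le_div_iff₀ (by linarith)] at hleη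
    nlinarith
  refine ⟨h, hpos, hlt, ?_⟩
  have hm := hmono (show x ∈ Ici b from hx) (show x + h ∈ Ici b from le_trans hx (by linarith))
    (by linarith : x ≤ x + h)
  simp only at hm
  -- exponential bookkeeping: F := e^{δh}
  set F : ℝ := Real.exp (δ * h) with hF
  have hF1 : 1 ≤ F := Real.one_le_exp (by positivity)
  have hFexp : F - 1 ≤ δ * h * F := by
    have h1 : -(δ * h) + 1 ≤ Real.exp (-(δ * h)) := Real.add_one_le_exp _
    have h2 : Real.exp (-(δ * h)) * F = 1 := by rw [hF, ← Real.exp_add]; simp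
    have h3 : 0 < F := Real.exp_pos _
    nlinarith
  have hFle : F ≤ Real.exp δ := Real.exp_le_exp.2 (by nlinarith)
  have hsplit : Real.exp (δ * (x + h)) = E * F := by rw [hE, hF, mul_add, Real.exp_add]
  rw [hsplit] at hm
  -- Φ(x+h) − Φ(x) = (C/δ) E (F − 1) ≤ (C/δ) E δ h F = h C E F
  have hCE : 0 ≤ C / δ * E := by positivity
  have hdiff : C / δ * (E * F) - C / δ * E ≤ h * (C * E) * F := by
    have h1 := mul_le_mul_of_nonneg_left hFexp hCE
    have e1 : C / δ * E * (δ * h * F) = h * (C * E) * F := by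
      field_simp
    nlinarith [h1, e1]
  -- h C E F ≤ h (C E + L h) ≤ h (C E + η)
  have hF2 : F ≤ 1 + δ * h * Real.exp δ := by
    have : δ * h * F ≤ δ * h * Real.exp δ := mul_le_mul_of_nonneg_left hFle (by positivity)
    linarith
  have hfin : h * (C * E) * F ≤ h * (C * E + η) := by
    have hCEh : 0 ≤ h * (C * E) := by positivity
    calc h * (C * E) * F ≤ h * (C * E) * (1 + δ * h * Real.exp δ) :=
          mul_le_mul_of_nonneg_left hF2 hCEh
      _ = h * (C * E + L * h) := by rw [hL]; ring
      _ ≤ h * (C * E + η) := mul_le_mul_of_nonneg_left (by linarith) hpos.le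
  linarith

/-- **Speed limit ⟺ monotone additive gauge** (from a base `b > 0`, rate `δ > 0`, constant `C ≥ 0`).
The ADDITIVE twin of MONO-F's multiplicative gauge `e^{4πe^{2a}} ε`. RH-free. [folklore] -/
theorem speedLimit_iff_monotoneOn_addGauge {b C δ : ℝ} (hb : 0 < b) (hC : 0 ≤ C) (hδ : 0 < δ) :
    (∀ x : ℝ, b ≤ x → ∀ η δ' : ℝ, 0 < η → 0 < δ' →
      ∃ h : ℝ, 0 < h ∧ h < δ' ∧
        weilGroundEnergy x - weilGroundEnergy (x + h) ≤ h * (C * Real.exp (δ * x) + η)) ↔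
    MonotoneOn (fun a ↦ weilGroundEnergy a + C / δ * Real.exp (δ * a)) (Ici b) :=
  ⟨monotoneOn_addGauge_of_speedLimit hb hC hδ, speedLimit_of_monotoneOn_addGauge hC hδ⟩

/-- **An additive exponential gauge that makes the Weil bottom eventually monotone bounds the zero strip.**
If `a ↦ ε a + (C/δ) e^{δa}` is non-decreasing on `[b, ∞)` (`b > 0`, `C ≥ 0`, `δ > 0`), then every
non-trivial zero has `|Re ρ − 1/2| ≤ δ/2`.  Direct (no fence): `ε a ≥ G b − (C/δ)e^{δa} ≥ −(|G b| + C/δ) e^{δa}`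
for `a ≥ b`, then the tree's exact-thermometer lemma.  CONDITIONAL; RH-free; no RH claim. [folklore] -/
theorem strip_half_of_monotoneOn_addGauge {b C δ : ℝ} (hb : 0 < b) (hC : 0 ≤ C) (hδ : 0 < δ)
    (hmono : MonotoneOn (fun a ↦ weilGroundEnergy a + C / δ * Real.exp (δ * a)) (Ici b))
    {ρ : ℂ} (hρ : ρ ∈ ZetaZeros.riemannZetaNontrivialZeros) : |ρ.re - 1 / 2| ≤ δ / 2 := by
  refine abs_re_sub_half_le_of_weilGroundEnergy_exp_lower (κ := δ)
    (C := |weilGroundEnergy b + C / δ * Real.exp (δ * b)| + C / δ) (a₀ := b) hδ.le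
    (fun a hba ↦ ?_) hρ
  have hm := hmono Set.self_mem_Ici (show a ∈ Ici b from hba) hba
  simp only at hm
  have ha : 0 ≤ δ * a := by nlinarith [hb, hba, hδ]
  have h1 : 1 ≤ Real.exp (δ * a) := Real.one_le_exp ha
  have hG : -|weilGroundEnergy b + C / δ * Real.exp (δ * b)| ≤
      weilGroundEnergy b + C / δ * Real.exp (δ * b) := neg_abs_le _
  have h2 : |weilGroundEnergy b + C / δ * Real.exp (δ * b)| ≤
      |weilGroundEnergy b + C / δ * Real.exp (δ * b)| * Real.exp (δ * a) :=
    le_mul_of_one_le_right (abs_nonneg _) h1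
  have h3 : 0 ≤ C / δ * Real.exp (δ * a) := by positivity
  nlinarith

/-! ## 3. Ω-forms: an off-line zero defeats the clause and the gauge from every base -/

/-- **A zero at offset `> δ/2` defeats the defective leakage clause at rate `δ` from EVERY base with EVERY
constant.**  CONDITIONAL on the zero; RH-free; no RH claim. [folklore] -/
theorem defectiveLeakage_fails_of_offline_zero {ρ₀ : ℂ} (hρ₀ : ρ₀ ∈ ZetaZeros.riemannZetaNontrivialZeros)
    {δ : ℝ} (hδ : 0 < δ) (hoff : δ / 2 < |ρ₀.re - 1 / 2|) {b C : ℝ} (hb : 0 < b) (hC : 0 ≤ C) :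
    ¬ (∀ A : ℝ, b ≤ A → ∃ K : ℝ, 0 ≤ K ∧ ∀ x ∈ Ico b A, ∀ η δ' : ℝ, 0 < η → 0 < δ' →
      ∃ h : ℝ, 0 < h ∧ h < δ' ∧
        weilGroundEnergy x - weilGroundEnergy (x + h) ≤
          h * (K * weilGroundEnergy x + C * Real.exp (δ * x) + η)) :=
  fun h ↦ absurd (strip_half_of_defectiveLeakage hb hC hδ h hρ₀) (not_le.2 hoff)

/-- **A zero at offset `> δ/2` defeats every additive gauge of rate `δ`**: `a ↦ ε a + (C/δ) e^{δa}` is NOT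
non-decreasing on any `[b, ∞)`.  CONDITIONAL on the zero; RH-free; no RH claim. [folklore] -/
theorem not_monotoneOn_addGauge_of_offline_zero {ρ₀ : ℂ} (hρ₀ : ρ₀ ∈ ZetaZeros.riemannZetaNontrivialZeros)
    {δ : ℝ} (hδ : 0 < δ) (hoff : δ / 2 < |ρ₀.re - 1 / 2|) {b C : ℝ} (hb : 0 < b) (hC : 0 ≤ C) :
    ¬ MonotoneOn (fun a ↦ weilGroundEnergy a + C / δ * Real.exp (δ * a)) (Ici b) :=
  fun h ↦ absurd (strip_half_of_monotoneOn_addGauge hb hC hδ h hρ₀) (not_le.2 hoff)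

/-- **Off RH some rate admits no additive gauge from any base.**  If RH fails there is `δ > 0` such that
for every base `b > 0` and every `C ≥ 0` the gauge `a ↦ ε a + (C/δ) e^{δa}` fails to be non-decreasing on
`[b, ∞)` (contrapositive of `riemannHypothesis_of_subexpSpeed`).  No RH claim. [folklore] -/
theorem exists_rate_of_not_riemannHypothesis (hRH : ¬ _root_.RiemannHypothesis) :
    ∃ δ : ℝ, 0 < δ ∧ ∀ b C : ℝ, 0 < b → 0 ≤ C →
      ¬ MonotoneOn (fun a ↦ weilGroundEnergy a + C / δ * Real.exp (δ * a)) (Ici b) := by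
  by_contra H
  push Not at H
  refine hRH (riemannHypothesis_of_subexpSpeed fun δ hδ ↦ ?_)
  obtain ⟨b, C, hb, hC, hmono⟩ := H δ hδ
  exact ⟨b, C, hb, hC, speedLimit_of_monotoneOn_addGauge hC hδ hmono⟩

end Summit.RiemannHypothesis.RiemannHypothesis.Theorems.PfPersistenceDefectiveTransport

end
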